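import Literature.AnabelianGeometry.SemiGraphs.FiniteEtaleCoveringComp
import Literature.AnabelianGeometry.SemiGraphs.Coverticial
import HarnessLib

/-!
# Composites of finite étale coverings are STAR-SHAPED at every constituent ([SemiAnbd] Def. 2.2 (i), p. 23)

Mochizuki, *Semi-graphs of anabelioids*, Publ. RIMS **42** (2006), §2, Def. 2.2 (i), author's manuscript
p. 23 [cite: MochizukiSemiAnbd2006, Def. 2.2(i) p.23]: for the covering `𝒢′ → 𝒢` attached to an object
of `B(𝒢)`, "`𝒢′_{v′}` is the anabelioid `(𝒢_v)_P`" of a connected component `P` — in the cell's local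
description `Hom.IsFiniteEtaleCoveringOf` (`Coverticial.lean`) this is the clause
`∃ α : Over P ⥤ 𝒢′_{v′}, α.IsEquivalence ∧ φ_{v′}^* ≅ (P × −) ⋙ α`, and likewise at edges.

PROOF-ONLY infrastructure for F-1478 (abc-iut cell, layer L3: residual «print's finite étale coverings
compose», sub-brick (L-S)₀ of the LOCAL clause of a composite; seat abc-iut-w5-d041; memo
`HOME/staging/w5/w5-d041-g3/L-LOCAL-CLAUSE-DECOMPOSITION.md` §1).  If `φ : 𝒢 → ℋ` is locally the covering
of `B` and `ψ : ℋ → 𝒦` is locally the covering of `A`, then at every vertex `v` (resp. edge `e`) of `𝒢`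
the composite `φ.comp ψ` (`HomComposition.lean`) is STAR-SHAPED: there are an object `S` of the constituent
anabelioid of `𝒦` under `v` (namely `S := (α_{ψ,w}⁻¹ Q_v).left` for `w = φ v`, `Q_v` the component of
`φ` at `v`) and an equivalence `α : (𝒦_u)_{/S} ⥲ 𝒢_v` with `(ψ ∘ φ)_v^* ≅ (S × −) ⋙ α`
(`Hom.IsFiniteEtaleCoveringOf.exists_starShape_vertex_comp` / `…_edge_comp`) — abc-iut-f-161's
`starEquivStarIso` applied VERTEXWISE.  What this does NOT give (the honest residual of the local
clause of a composite): that `S` is a connected SUBOBJECT of the constituent `C.S(u)` of the object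
`C ∈ B(𝒦)` of the composite's global clause, and the branch clause — see the memo, bricks (L-σ)/(L-B);
the comparison engine is `OverStarSectionRigidity.lean`.  No definition of the cell is touched; no
`Prop` is asserted; nothing here bears on [IUTchIII] Cor. 3.12.
-/

namespace Literature.AnabelianGeometry.SemiGraphs

namespace SemiGraphOfAnabelioids

open CategoryTheory CategoryTheory.Limits

universe v₁ u₁ u

variable {𝒢 ℋ 𝒦 : SemiGraphOfAnabelioids.{v₁, u₁, u}}

/-- Star-shape composes (pure category theory): if `F ≅ (P × −) ⋙ αψ` and `G ≅ (Q × −) ⋙ αφ` with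
`αψ : X_{/P} ⥤ Y`, `αφ : Y_{/Q} ⥤ Z` equivalences, then `F ⋙ G ≅ (S × −) ⋙ α` for `S := (αψ⁻¹ Q).left`
and an equivalence `α : X_{/S} ⥤ Z` (abc-iut-f-161's `starEquivStarIso`, whiskered).
[cite: MochizukiSemiAnbd2006, Def. 2.2(i) p.23] -/
theorem exists_starShape_comp {X Y Z : Type*} [Category X] [Category Y] [Category Z]
    [HasBinaryProducts X] [HasBinaryProducts Y] {P : X} {Q : Y} (F : X ⥤ Y) (G : Y ⥤ Z)
    (αψ : Over P ⥤ Y) [αψ.IsEquivalence] (eψ : F ≅ Over.star P ⋙ αψ)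
    (αφ : Over Q ⥤ Z) [αφ.IsEquivalence] (eφ : G ≅ Over.star Q ⋙ αφ) :
    ∃ α : Over (αψ.inv.obj Q).left ⥤ Z, α.IsEquivalence ∧ Nonempty (F ⋙ G ≅ Over.star _ ⋙ α) := by
  let E : Over Q ⥤ Over (αψ.inv.obj Q).left :=
    Over.post αψ.inv ⋙ ((αψ.inv.obj Q).iteratedSliceEquiv).functor
  refine ⟨E.inv ⋙ αφ, inferInstance, ⟨?_⟩⟩
  exact Functor.isoWhiskerRight eψ G ≪≫ Functor.isoWhiskerLeft (Over.star P ⋙ αψ) eφ ≪≫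
    Functor.isoWhiskerRight (starEquivStarIso P αψ Q) αφ

/-- **A composite of locally-attached coverings is star-shaped at every vertex**: for `φ : 𝒢 → ℋ`
locally the covering attached to `B` and `ψ : ℋ → 𝒦` locally the covering attached to `A`, at every
vertex `v` of `𝒢` there are an object `S` of `𝒦_u` (`u` the image of `v`) and an equivalence
`α : (𝒦_u)_{/S} ⥲ 𝒢_v` with `(ψ ∘ φ)_v^* ≅ (S × −) ⋙ α`. [cite: MochizukiSemiAnbd2006, Def. 2.2(i) p.23] -/
theorem Hom.IsFiniteEtaleCoveringOf.exists_starShape_vertex_comp {φ : Hom 𝒢 ℋ} {ψ : Hom ℋ 𝒦}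
    {B : ℋ.BObj} {A : 𝒦.BObj} (hφ : φ.IsFiniteEtaleCoveringOf B) (hψ : ψ.IsFiniteEtaleCoveringOf A)
    (v : 𝒢.graph.Vertex) :
    ∃ (S : 𝒦.V ((φ.comp ψ).base.vertexMap v)) (α : Over S ⥤ 𝒢.V v),
      α.IsEquivalence ∧ Nonempty (((φ.comp ψ).φV v).pullback ≅ Over.star S ⋙ α) := by
  obtain ⟨-, cVφ, -, -, -, hVφ, -, -⟩ := hφ
  obtain ⟨-, cVψ, -, -, -, hVψ, -, -⟩ := hψ
  obtain ⟨αφ, hαφ, ⟨eφ⟩⟩ := hVφ v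
  obtain ⟨αψ, hαψ, ⟨eψ⟩⟩ := hVψ (φ.base.vertexMap v)
  obtain ⟨α, hα, ⟨e⟩⟩ := exists_starShape_comp (ψ.φV (φ.base.vertexMap v)).pullback
    (φ.φV v).pullback αψ eψ αφ eφ
  exact ⟨_, α, hα, ⟨e⟩⟩

/-- **A composite of locally-attached coverings is star-shaped at every edge** (edge analogue of
`exists_starShape_vertex_comp`). [cite: MochizukiSemiAnbd2006, Def. 2.2(i) p.23] -/
theorem Hom.IsFiniteEtaleCoveringOf.exists_starShape_edge_comp {φ : Hom 𝒢 ℋ} {ψ : Hom ℋ 𝒦}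
    {B : ℋ.BObj} {A : 𝒦.BObj} (hφ : φ.IsFiniteEtaleCoveringOf B) (hψ : ψ.IsFiniteEtaleCoveringOf A)
    (e : 𝒢.graph.Edge) :
    ∃ (S : 𝒦.E ((φ.comp ψ).base.edgeMap e)) (α : Over S ⥤ 𝒢.E e),
      α.IsEquivalence ∧
        Nonempty (((φ.comp ψ).φE e ((φ.comp ψ).base.edgeMap e) rfl).pullback ≅ Over.star S ⋙ α) := by
  obtain ⟨-, -, cEφ, -, -, -, hEφ, -⟩ := hφ
  obtain ⟨-, -, cEψ, -, -, -, hEψ, -⟩ := hψ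
  obtain ⟨αφ, hαφ, ⟨eφ⟩⟩ := hEφ e
  obtain ⟨αψ, hαψ, ⟨eψ⟩⟩ := hEψ (φ.base.edgeMap e)
  obtain ⟨α, hα, ⟨e'⟩⟩ := exists_starShape_comp (ψ.φE (φ.base.edgeMap e) _ rfl).pullback
    (φ.φE e _ rfl).pullback αψ eψ αφ eφ
  exact ⟨_, α, hα, ⟨e'⟩⟩

end SemiGraphOfAnabelioids

end Literature.AnabelianGeometry.SemiGraphs
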